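import Summits.QuantumFields.YangMills.Theorems.FiniteRankMirrorCrossPeelingPairs
import Summits.QuantumFields.YangMills.Theorems.BalabanLadderInfVolFloorsCore
import HarnessLib

/-!
# Route `FiniteRankMirror`, LINE g9-1 «two-cube Markov peeling» — the cross glue `CrossPeelingGlue`

Ideator seat ym-idea-8 (generation 9, lens «dual»).  Proves the glue item
`Summit.QuantumFields.YangMills.Theses.FiniteRankMirror.CrossPeelingGlue` (stmt-QuantumFields-23839):
`FemtoResponseMoments → TwoCubePeeling → MirrorCrossDecay` — the pointwise `dist⁻⁸` mirror two-point CEILING of the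
plaquette action density at the pinned finite-rank unit follows from the pinned singleton femto RESPONSE-MOMENT law (the
`n = 1` clause of the spine's (RM)).  Constants: `ℓ₄ := ℓ₁/4`, `β₆ := max β₁ β_a` (`a(β) < ℓ₄` beyond `β_a`),
`Λ₆ := 16ℓ₄`, `C := 1024·32⁸·e^B·C₁² + 2·C_D²·14⁸`; for mirror sup-distance `D ≥ 8` the radius is `R := ⌊(D−6)/2⌋` and
`FiniteRankMirrorPeeling.abs_mirrorCov_dens_le_of_expMoments` applies; for `D ≤ 7` the trivial bound `2C_D²`.

HONEST FRAMING: bookkeeping over the OPEN engine item `FemtoResponseMoments` (spine-owed); nothing of E0′, (RM), NT or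
the mass gap is proved here; no summit is proved by this line; not Clay.
-/

set_option autoImplicit false

noncomputable section

open MeasureTheory Filter Topology
open Literature.MathematicalPhysics.QuantumFieldTheory Literature.MathematicalPhysics.QuantumLattice
open Literature.Probability.LatticeModels
open Summit.QuantumFields.YangMills.Cruxes.OSLegsFromFemtoAndGap.DlrCollarTransfer
open Summit.QuantumFields.YangMills.Cruxes.OSLegsFromFemtoAndGap.DlrCollarTransfer.StubLower (exists_abs_dens_le)
open Summit.QuantumFields.YangMills.Theorems.OSLegsFromFemtoAndGap.StubLower (abs_apply_le_norm norm_le_two_mul_of_forall_abs_le)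
open Summit.QuantumFields.YangMills.Theorems.InfiniteVolume (abs_torusE_le)

namespace Summit.QuantumFields.YangMills.Cruxes.FiniteRankMirrorPeeling

variable (G : Type) [Group G] [TopologicalSpace G] [IsTopologicalGroup G] [CompactSpace G]
  [MeasurableSpace G] [BorelSpace G] (r : LatticeRep G)

/-! ## §5 Assembly: `FemtoResponseMoments → TwoCubePeeling → MirrorCrossDecay` -/

omit [Group G] [TopologicalSpace G] [IsTopologicalGroup G] [CompactSpace G] [MeasurableSpace G] [BorelSpace G] r in
/-- A lattice coordinate is controlled by the scaled Euclidean norm: `‖a • siteToE x‖ ≤ ℓ`, `0 < a` ⇒ `|x j|·a ≤ ℓ`. [folklore] -/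
theorem abs_coord_mul_le {a ℓ : ℝ} (ha : 0 < a) {x : Fin 4 → ℤ} (h : ‖a • siteToE x‖ ≤ ℓ) (j : Fin 4) :
    |(x j : ℝ)| * a ≤ ℓ := by
  have h1 : |(a • siteToE x) j| ≤ ‖a • siteToE x‖ := abs_apply_le_norm _ j
  have h2 : (a • siteToE x) j = a * (x j : ℝ) := by
    simp [siteToE_apply]
  rw [h2, abs_mul, abs_of_pos ha] at h1
  linarith [mul_comm (|(x j : ℝ)|) a]

/-- **The cross-peeling glue** (route `FiniteRankMirror`, LINE g9-1): the pinned singleton femto response-moment law and two-cube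
peeling give the pointwise `dist⁻⁸` mirror two-point ceiling `MirrorCrossDecay`. [folklore bookkeeping over (RM)] -/
theorem crossPeelingGlue_proof :
    Summit.QuantumFields.YangMills.Theses.FiniteRankMirror.FemtoResponseMoments →
      Summit.QuantumFields.YangMills.Theses.FiniteRankMirror.TwoCubePeeling →
        Summit.QuantumFields.YangMills.Theses.FiniteRankMirror.MirrorCrossDecay := by
  intro hRM _hTCP G _ _ _ _ hG
  letI : MeasurableSpace G := borel G
  haveI : BorelSpace G := ⟨rfl⟩
  intro r a ha₀ ha hpin
  -- the pin of `MirrorCrossDecay` (finite-menu floor, any window) feeds the pin of the response law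
  obtain ⟨J, p, κ, _hp8, hκ, hmenu⟩ := hpin
  obtain ⟨ℓ, v, β₅, Λ₅, hℓ0, _hℓ1, hv, hfloor⟩ := hmenu 1 one_pos
  obtain ⟨p', C₁, B, β₁, ℓ₁, hC₁, hℓ₁, hlaw⟩ := hRM G hG r a ha₀ ha
    ⟨J, v, κ * ℓ ^ p, β₅, Λ₅, fun j => (hv j).1, mul_pos hκ (Real.rpow_pos_of_pos hℓ0 p), hfloor⟩
  -- uniform bound on the densities
  obtain ⟨CD, hCD0, hCD⟩ := exists_abs_dens_le (G := G) r
  -- the unit is eventually below `ℓ₄ := ℓ₁ / 4`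
  set ℓ₄ : ℝ := ℓ₁ / 4 with hℓ₄
  have hℓ₄0 : 0 < ℓ₄ := by positivity
  obtain ⟨βa, hβa⟩ := Filter.eventually_atTop.1 (ha.eventually (Iio_mem_nhds hℓ₄0))
  -- the constant
  set Cbig : ℝ := 1024 * 32 ^ 8 * Real.exp B * C₁ ^ 2 + 2 * CD ^ 2 * 14 ^ 8 with hCbig
  refine ⟨ℓ₄, Cbig, max β₁ βa, 16 * ℓ₄, hℓ₄0, ?_⟩
  intro β hβ L hL x y hx0 hy0 hx hy
  have hβ₁ : β₁ ≤ β := le_trans (le_max_left _ _) hβ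
  have haℓ : a β < ℓ₄ := hβa β (le_trans (le_max_right _ _) hβ)
  have ha0 : 0 < a β := ha₀ β
  have hxj : ∀ j, |(x j : ℝ)| * a β ≤ ℓ₄ := fun j => abs_coord_mul_le ha0 hx j
  have hyj : ∀ j, |(y j : ℝ)| * a β ≤ ℓ₄ := fun j => abs_coord_mul_le ha0 hy j
  -- the mirror vector and its sup-size
  set m : Fin 4 → ℤ := Function.update (x - y) 0 (x 0 + y 0) with hm
  have hm0 : m 0 = x 0 + y 0 := by simp [hm]
  have hmj : ∀ j : Fin 4, j ≠ 0 → m j = x j - y j := fun j hj => by simp [hm, hj]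
  set D : ℕ := max (max (m 0).natAbs (m 1).natAbs) (max (m 2).natAbs (m 3).natAbs) with hD
  have hDle : ∀ j : Fin 4, (m j).natAbs ≤ D := by
    intro j
    fin_cases j
    exacts [le_max_of_le_left (le_max_left _ _), le_max_of_le_left (le_max_right _ _),
      le_max_of_le_right (le_max_left _ _), le_max_of_le_right (le_max_right _ _)]
  have cast_natAbs : ∀ k : ℤ, ((k.natAbs : ℕ) : ℝ) = |(k : ℝ)| := fun k => by
    rw [← Int.cast_natCast, Int.natCast_natAbs, Int.cast_abs]
  have hDex : ∃ j : Fin 4, (m j).natAbs = D := by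
    rcases max_choice (max (m 0).natAbs (m 1).natAbs) (max (m 2).natAbs (m 3).natAbs) with h | h
    · rcases max_choice (m 0).natAbs (m 1).natAbs with h' | h'
      · exact ⟨0, by rw [hD, h, h']⟩
      · exact ⟨1, by rw [hD, h, h']⟩
    · rcases max_choice (m 2).natAbs (m 3).natAbs with h' | h'
      · exact ⟨2, by rw [hD, h, h']⟩
      · exact ⟨3, by rw [hD, h, h']⟩
  have hD2 : x 0 + y 0 ≤ (D : ℤ) := by
    have h := hDle 0
    rw [hm0] at h
    omega
  -- real-valued facts about `D` and the norm of the mirror vector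
  have hDa : (D : ℝ) * a β ≤ 2 * ℓ₄ := by
    obtain ⟨j₀, hj₀⟩ := hDex
    have hcast : (D : ℝ) = |(m j₀ : ℝ)| := by
      rw [← hj₀, cast_natAbs]
    by_cases hj : j₀ = 0
    · subst hj
      rw [hcast, hm0]
      push_cast
      have := abs_add_le (x 0 : ℝ) (y 0)
      nlinarith [hxj 0, hyj 0, ha0.le]
    · rw [hcast, hmj j₀ hj]
      push_cast
      have := abs_sub (x j₀ : ℝ) (y j₀)
      nlinarith [hxj j₀, hyj j₀, ha0.le]
  have hnorm_le : ‖siteToE m‖ ≤ 2 * (D : ℝ) := by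
    refine norm_le_two_mul_of_forall_abs_le _ (Nat.cast_nonneg D) fun j => ?_
    rw [siteToE_apply, ← cast_natAbs]
    exact Nat.cast_le.2 (hDle j)
  have hnorm_pos : 0 < ‖siteToE m‖ := by
    have h := abs_apply_le_norm (siteToE m) 0
    rw [siteToE_apply, hm0] at h
    push_cast at h
    have : (2 : ℝ) ≤ |(x 0 : ℝ) + (y 0 : ℝ)| := by
      rw [abs_of_nonneg (by positivity)]
      have : (1 : ℝ) ≤ x 0 := by exact_mod_cast hx0
      have : (1 : ℝ) ≤ y 0 := by exact_mod_cast hy0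
      linarith
    linarith
  have hCbig1 : 2 * CD ^ 2 * 14 ^ 8 ≤ Cbig := by
    rw [hCbig]; nlinarith [Real.exp_pos B, sq_nonneg C₁]
  have hCbig2 : 1024 * 32 ^ 8 * Real.exp B * C₁ ^ 2 ≤ Cbig := by
    rw [hCbig]; nlinarith [sq_nonneg CD]
  by_cases hD8 : D < 8
  · -- short mirror distance: the trivial bound
    have htriv : |torusE G r β L (fun V => dens G r x (cfgReflect V) * dens G r y V) -
        torusE G r β L (dens G r x) * torusE G r β L (dens G r y)| ≤ 2 * CD ^ 2 := by
      have h1 : |torusE G r β L (fun V => dens G r x (cfgReflect V) * dens G r y V)| ≤ CD * CD :=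
        abs_torusE_le r β L (fun U => by
          rw [abs_mul]; exact mul_le_mul (hCD x _) (hCD y U) (abs_nonneg _) hCD0)
      have h2 : |torusE G r β L (dens G r x) * torusE G r β L (dens G r y)| ≤ CD * CD := by
        rw [abs_mul]
        exact mul_le_mul (abs_torusE_le r β L (hCD x)) (abs_torusE_le r β L (hCD y)) (abs_nonneg _) hCD0
      calc _ ≤ |torusE G r β L (fun V => dens G r x (cfgReflect V) * dens G r y V)| +
            |torusE G r β L (dens G r x) * torusE G r β L (dens G r y)| := abs_sub _ _
        _ ≤ CD * CD + CD * CD := add_le_add h1 h2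
        _ = 2 * CD ^ 2 := by ring
    have hn14 : ‖siteToE m‖ ≤ 14 := by
      have : (D : ℝ) ≤ 7 := by exact_mod_cast Nat.lt_succ_iff.1 hD8
      linarith
    have hpow : ‖siteToE m‖ ^ 8 ≤ 14 ^ 8 := pow_le_pow_left₀ (norm_nonneg _) hn14 8
    have hpow0 : 0 < ‖siteToE m‖ ^ 8 := by positivity
    calc _ ≤ 2 * CD ^ 2 := htriv
      _ = (2 * CD ^ 2 * ‖siteToE m‖ ^ 8) / ‖siteToE m‖ ^ 8 := by field_simp
      _ ≤ (2 * CD ^ 2 * 14 ^ 8) / ‖siteToE m‖ ^ 8 := by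
          apply div_le_div_of_nonneg_right _ hpow0.le
          exact mul_le_mul_of_nonneg_left hpow (by positivity)
      _ ≤ Cbig / ‖siteToE m‖ ^ 8 := div_le_div_of_nonneg_right hCbig1 hpow0.le
  · -- long mirror distance: peel both cubes at radius R = ⌊(D − 6)/2⌋
    push Not at hD8
    set R : ℕ := (D - 6) / 2 with hR
    have hR1 : 1 ≤ R := by omega
    have h2R : 2 * R + 6 ≤ D := by omega
    have hD2R : D ≤ 2 * R + 7 := by omega
    have hRa : (R : ℝ) * a β ≤ ℓ₄ := by
      have : (2 * R : ℝ) ≤ D := by exact_mod_cast (by omega : 2 * R ≤ D)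
      nlinarith [ha0.le]
    have hLa : 16 * ℓ₄ ≤ a β * L := hL
    -- windows
    have hwin : ∀ z : Fin 4 → ℤ, (∀ j, |(z j : ℝ)| * a β ≤ ℓ₄) → ∀ j, |z j| + (R : ℤ) + 7 ≤ (L : ℤ) := by
      intro z hz j
      have h1 : (|(z j : ℝ)| + R + 7) * a β < (L : ℝ) * a β := by
        have := hz j
        nlinarith [ha0]
      have h2 : |(z j : ℝ)| + R + 7 < L := lt_of_mul_lt_mul_right h1 ha0.le
      have h4 : |z j| + (R : ℤ) + 7 < (L : ℤ) := by exact_mod_cast h2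
      exact h4.le
    have hRL : 4 * R + 8 ≤ L := by
      have h1 : ((4 * R + 8 : ℕ) : ℝ) * a β < (L : ℝ) * a β := by
        push_cast
        nlinarith [ha0]
      exact_mod_cast (lt_of_mul_lt_mul_right h1 ha0.le).le
    -- separation
    have hsep : 2 * (R : ℤ) + 6 ≤ x 0 + y 0 ∨
        ∃ j, j ≠ 0 ∧ (x j + 2 * (R : ℤ) + 6 ≤ y j ∨ y j + 2 * (R : ℤ) + 6 ≤ x j) := by
      obtain ⟨j₀, hj₀⟩ := hDex
      by_cases hj : j₀ = 0
      · subst hj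
        left
        rw [hm0] at hj₀
        omega
      · right
        refine ⟨j₀, hj, ?_⟩
        rw [hmj j₀ hj] at hj₀
        omega
    -- the law at radius R on this torus
    have hlawR : ∀ (q : Fin 4 × Fin 4) (z : Fin 4 → ℤ), q.1 < q.2 →
        torusE G r β L (fun U => Real.exp ((R : ℝ) ^ 4 / C₁ *
          |kerE G r β (fun k => z k - ((R : ℤ) + 1)) (2 * R + 3) U (plane G r q z) - p' q β|)) ≤ Real.exp B :=
      fun q z hq => hlaw β hβ₁ L q z R hq hR1 (hRa.trans (by rw [hℓ₄]; linarith)) hRL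
    have hmain := abs_mirrorCov_dens_le_of_expMoments G r hR1 x y (hwin x hxj) (hwin y hyj) hsep hC₁
      (fun q => p' q β) hlawR
    -- conversion `R⁻⁸ ≤ 32⁸ ‖m‖⁻⁸`
    have hRm : ‖siteToE m‖ ≤ 32 * (R : ℝ) := by
      have h1 : (D : ℝ) ≤ 2 * R + 7 := by exact_mod_cast hD2R
      have h2 : (8 : ℝ) ≤ D := by exact_mod_cast hD8
      nlinarith
    have hRpos : (0 : ℝ) < R := by exact_mod_cast hR1
    have hpow : ‖siteToE m‖ ^ 8 ≤ 32 ^ 8 * (R : ℝ) ^ 8 := by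
      calc ‖siteToE m‖ ^ 8 ≤ (32 * (R : ℝ)) ^ 8 := pow_le_pow_left₀ (norm_nonneg _) hRm 8
        _ = 32 ^ 8 * (R : ℝ) ^ 8 := by ring
    have hpow0 : 0 < ‖siteToE m‖ ^ 8 := by positivity
    calc _ ≤ 256 * (4 * Real.exp B * C₁ ^ 2 / (R : ℝ) ^ 8) := hmain
      _ = (1024 * Real.exp B * C₁ ^ 2) / (R : ℝ) ^ 8 := by ring
      _ ≤ (1024 * 32 ^ 8 * Real.exp B * C₁ ^ 2) / ‖siteToE m‖ ^ 8 := by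
          rw [div_le_div_iff₀ (by positivity) hpow0]
          calc 1024 * Real.exp B * C₁ ^ 2 * ‖siteToE m‖ ^ 8
              ≤ 1024 * Real.exp B * C₁ ^ 2 * (32 ^ 8 * (R : ℝ) ^ 8) :=
                mul_le_mul_of_nonneg_left hpow (by positivity)
            _ = 1024 * 32 ^ 8 * Real.exp B * C₁ ^ 2 * (R : ℝ) ^ 8 := by ring
      _ ≤ Cbig / ‖siteToE m‖ ^ 8 := div_le_div_of_nonneg_right hCbig2 hpow0.le

end Summit.QuantumFields.YangMills.Cruxes.FiniteRankMirrorPeeling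

/-- **The cross-peeling glue** — item `CrossPeelingGlue` of route `FiniteRankMirror` (stmt-QuantumFields-23839, LINE g9-1
of ideator seat ym-idea-8): `FemtoResponseMoments → TwoCubePeeling → MirrorCrossDecay`. [folklore bookkeeping] -/
theorem Summit.QuantumFields.YangMills.Theorems.finiteRankMirror_crossPeelingGlue :
    Summit.QuantumFields.YangMills.Theses.FiniteRankMirror.CrossPeelingGlue :=
  Summit.QuantumFields.YangMills.Cruxes.FiniteRankMirrorPeeling.crossPeelingGlue_proof

end
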